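import Literature.AnabelianGeometry.SemiGraphs.TemperedCosetTowerNoFixedBranchPairOfTower
import Literature.AnabelianGeometry.SemiGraphs.GaloisLevelDataChart
import Literature.AnabelianGeometry.SemiGraphs.GaloisLevelDataOfOpenNormal
import Literature.AnabelianGeometry.SemiGraphs.FiniteCoveringsGalois
import HarnessLib

/-!
# [SemiAnbd] Thm 5.4 (i) p. 66 / Thm 3.7 (iii) p. 41: the capstone binder `hnobpNCpt` at the coset tower of
# an ARBITRARY cofinal Galois tower and ITS chart; vertex-faithfulness transported along domination (proof-only)

Mochizuki, *Semi-graphs of anabelioids*, Publ. RIMS **42** (2006), §3, proof of Thm. 3.7 (iii) p. 41; §5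
Thm. 5.4 (i) p. 66 [cite: MochizukiSemiAnbd2006, Thm 3.7(iii) p.41].  abc-iut cell, layer L3, GAP-LEDGER row
G-w4d053-1 (T54-B), E1 junction (capstone v3 at the characteristic tower); seat abc-iut-w4-d053 gen 3.
PROOF-ONLY (no definition, no named fact).

abc-iut-w4-d083's `hnobpNCpt_cosetTower_of_faithV` / `…_holds` (TemperedCosetTowerNoFixedBranchPairOfTower.lean)
produce the capstone binder `hnobpNCpt` at the CANONICAL tower `𝒢.galoisLevelData h36` with the chart
`𝒢.temperedPiChart h36`; the two engines under them (`GaloisLevelData.hnobpCpt_cosetLevels_of_orbitLevels`,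
`…hnobpCpt_orbitLevels_of_stabBranchPairCpt'`) and abc-iut-L3-t11's `GaloisLevelData.stabBranchPairCpt'_ofTower'`
are already generic in the tower.  For the capstone v3 at abc-iut-L3-t9's CHARACTERISTIC tower (its own chart
`D.chart …`, GaloisLevelDataChart.lean) this file supplies:

* `hnobpNCpt_cosetTower_of_faithV_chart` — the binder text at ANY cofinal Galois tower `D` and its chart
  `D.chart …` (ρ := id), modulo the vertex-faithfulness input (I0v) `hfaithV` of THAT tower;
* `GaloisLevelData.faithfulV_of_dominates` — (I0v) TRANSPORTS along domination: if every level of a tower `D`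
  receives a fibre-surjective morphism from some level of `D'`, then (I0v) for `D` implies (I0v) for `D'`
  (equivariance of the fibre maps);
* `faithfulV_ofOpenNormalSeq` — (I0v) for t9's prescribed tower `GaloisLevelData.ofOpenNormalSeq …` whenever
  its levels `V k` are eventually below the base-point stabilisers of the enumerated tower (domination
  `ofOpenNormalSeq_dominates`; fibre maps between Galois levels are onto — epimorphisms of a Galois category,
  `ofBObj_map_fV_surjective_of_isGalois` + fullness of `ofBObj`), from abc-iut-L3-t6's THEOREM
  `galoisLevelData_faithfulV` for the enumerated tower;
* `hnobpNCpt_ofOpenNormalSeq` — hence the capstone binder `hnobpNCpt` at the characteristic tower is a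
  theorem modulo that domination hypothesis alone (satisfied by the characteristic open cores,
  `charOpenCore_le_stabilizer_basePoint`).

Nothing here bears on [IUTchIII] Cor. 3.12; typed ≠ proved for Thm 5.4.
-/

namespace Literature.AnabelianGeometry.SemiGraphs

namespace ProfiniteSemiGraph

open CategoryTheory Topology

universe u v

variable {𝒢 : ProfiniteSemiGraph.{u}}

namespace GaloisLevelData

/-! ### (I0v) transports along domination -/

/-- **Vertex-faithfulness (I0v) transports along domination**: if every level `D.S n` receives a morphism
from some level `D'.S k` which is onto on every vertex fibre, and every `𝒢_v` acts faithfully on the fibres of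
`D`, then every `𝒢_v` acts faithfully on the fibres of `D'` (the fibre maps are `𝒢_v`-equivariant).
[cite: MochizukiSemiAnbd2006, Thm 3.7(i) p.40] -/
theorem faithfulV_of_dominates (D D' : GaloisLevelData 𝒢)
    (hdom : ∀ n : ℕ, ∃ (k : ℕ) (f : D'.S k ⟶ D.S n), ∀ v, Function.Surjective (f.fV v).hom.hom)
    (hfaith : ∀ (v : 𝒢.graph.Vertex) (h : 𝒢.Gv v),
      (∀ (n : ℕ) (x : ((D.S n).SV v).obj.V), ((D.S n).SV v).obj.ρ h x = x) → h = 1) :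
    ∀ (v : 𝒢.graph.Vertex) (h : 𝒢.Gv v),
      (∀ (k : ℕ) (y : ((D'.S k).SV v).obj.V), ((D'.S k).SV v).obj.ρ h y = y) → h = 1 := by
  intro v h hfix
  refine hfaith v h fun n x => ?_
  obtain ⟨k, f, hf⟩ := hdom n
  obtain ⟨y, rfl⟩ := hf v x
  rw [← CovHom.fV_ρ_apply f v h y, hfix k y]

end GaloisLevelData

/-! ### `hnobpNCpt` at an arbitrary tower and its chart -/

section Chart

variable (D : GaloisLevelData 𝒢) (h𝒢 : 𝒢.IsCountable)
  (hcof : ∀ (T : CovObj 𝒢), T.IsTempered → ∀ p : T.Point,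
    ∃ i : ℕ, ∀ j, i ≤ j → (D.S j).Splits (T.component p))
  (hcn : 𝒢.graph.IsConnected) (hS : ∀ n, (D.S n).Splits (D.S n)) (hfin : ∀ n, (D.S n).IsFinite)
  (hne : ∀ n, (D.S n).HasNonemptyFibres)
  (hconn : ∀ (n : ℕ) (p q : (D.S n).Point), (D.S n).SameComponent p q)
  (T : ∀ w : 𝒢.graph.Vertex, D.PointSeq h𝒢 w) (R : SemiGraph.RefBranches 𝒢.graph)

include hcof hcn hS hfin hne in
/-- **The capstone binder `hnobpNCpt` at the coset tower of ANY cofinal Galois tower `D`, for the chart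
`D.chart` (ρ := id), modulo (I0v) for that tower** (abc-iut-w4-d083's `hnobpNCpt_cosetTower_of_faithV`, tower
and chart generalised; same composition `hnobpCpt_cosetLevels_of_orbitLevels ∘
hnobpCpt_orbitLevels_of_stabBranchPairCpt' ∘ stabBranchPairCpt'_ofTower'`).
[cite: MochizukiSemiAnbd2006, Thm 5.4 (i), p. 66] -/
theorem hnobpNCpt_cosetTower_of_faithV_chart (h37 : 𝒢.Thm37Hypotheses) {E : Type v} [Group E]
    {Φ : E →* MulAut (D.temperedPi h𝒢)} {σ : E →* Aut 𝒢.graph}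
    (hP : (D.piPresentation h𝒢 T R).IsArithCompatible Φ σ)
    (hN : ∀ (n : ℕ) (e : E) (x : D.temperedPi h𝒢),
      x ∈ (D.piLevelAut h𝒢 hconn n).ker → Φ e x ∈ (D.piLevelAut h𝒢 hconn n).ker)
    (ι : D.temperedPi h𝒢 →* E) (hιΦ : ∀ g, Φ (ι g) = MulAut.conj g) (hισ : ∀ g, σ (ι g) = 1)
    (hfaithV : ∀ (v : 𝒢.graph.Vertex) (h : 𝒢.Gv v),
      (∀ (n : ℕ) (x : ((D.S n).SV v).obj.V), ((D.S n).SV v).obj.ρ h x = x) → h = 1) :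
    ∀ (C : Subgroup (D.temperedPi h𝒢)), IsCompact (C : Set (D.temperedPi h𝒢)) →
      ∀ (j₀ : ℕ) (w : ∀ i : {i : ℕ // j₀ ≤ i},
        ((D.piPresentation h𝒢 T R).cosetGraph (D.piLevelAut h𝒢 hconn i.1).ker).Vertex)
      (β β' : ∀ i : {i : ℕ // j₀ ≤ i},
        ((D.piPresentation h𝒢 T R).cosetGraph (D.piLevelAut h𝒢 hconn i.1).ker).Branch),
      (∀ i, β i ≠ β' i ∧
        ((D.piPresentation h𝒢 T R).cosetGraph (D.piLevelAut h𝒢 hconn i.1).ker).abuts (β i) = some (w i) ∧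
        ((D.piPresentation h𝒢 T R).cosetGraph (D.piLevelAut h𝒢 hconn i.1).ker).abuts (β' i) = some (w i)) →
      (∀ ⦃i i' : {i : ℕ // j₀ ≤ i}⦄ (h : i.1 ≤ i'.1),
        ((D.piPresentation h𝒢 T R).cosetGraphTrans (D.ker_piLevelAut_anti h𝒢 hconn h)).vertexMap (w i') = w i ∧
        ((D.piPresentation h𝒢 T R).cosetGraphTrans (D.ker_piLevelAut_anti h𝒢 hconn h)).branchMap (β i') = β i ∧
        ((D.piPresentation h𝒢 T R).cosetGraphTrans (D.ker_piLevelAut_anti h𝒢 hconn h)).branchMap (β' i') =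
          β' i) →
      (∀ (i : {i : ℕ // j₀ ≤ i}) (γ : C),
        ((D.piPresentation h𝒢 T R).arithAct hP (D.piLevelAut h𝒢 hconn i.1).ker (hN i.1) (ι γ)).hom.vertexMap
            (w i) = w i ∧
        ((D.piPresentation h𝒢 T R).arithAct hP (D.piLevelAut h𝒢 hconn i.1).ker (hN i.1) (ι γ)).hom.branchMap
            (β i) = β i ∧
        ((D.piPresentation h𝒢 T R).arithAct hP (D.piLevelAut h𝒢 hconn i.1).ker (hN i.1) (ι γ)).hom.branchMap
            (β' i) = β' i) → C = ⊥ :=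
  D.hnobpCpt_cosetLevels_of_orbitLevels h𝒢 hconn T R hP hN ι hιΦ hισ
    (D.hnobpCpt_orbitLevels_of_stabBranchPairCpt' h𝒢 hconn h37 (D.chart h𝒢 hcof hcn hS hfin hne)
      (MonoidHom.id _) fun C hC j₀ w β β' hpair hcompat =>
        D.stabBranchPairCpt'_ofTower' h𝒢 hconn (D.chart h𝒢 hcof hcn hS hfin hne) (MonoidHom.id _)
          continuous_id Function.injective_id hfaithV C hC j₀ w β β' hpair hcompat)

end Chart

/-! ### (I0v) and `hnobpNCpt` for the prescribed open-normal tower -/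

section OpenNormal

variable (𝒢)
variable (h37 : 𝒢.Thm37Hypotheses)
  (V : ℕ → OpenSubgroup (Aut (𝒢.fiberAt (𝒢.baseVertex h37.toProp36Hypotheses))))
  (hVn : ∀ k, (V k).toSubgroup.Normal) (hanti : ∀ k, (V (k + 1)).toSubgroup ≤ (V k).toSubgroup)
  (hdom : ∀ i, ∃ k, (V k).toSubgroup ≤
    MulAction.stabilizer (Aut (𝒢.fiberAt (𝒢.baseVertex h37.toProp36Hypotheses)))
      (show (𝒢.fiberAt (𝒢.baseVertex h37.toProp36Hypotheses)).obj (𝒢.tower h37.toProp36Hypotheses i) from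
        𝒢.basePoint h37.toProp36Hypotheses i))

include hdom in
/-- **(I0v) for the prescribed open-normal tower**: every `𝒢_v` acts faithfully on the fibres of
`GaloisLevelData.ofOpenNormalSeq …` as soon as its levels dominate the enumerated tower (domination
`ofOpenNormalSeq_dominates`; the dominating maps are onto on fibres — epimorphisms between connected Galois
objects —; (I0v) for the enumerated tower is abc-iut-L3-t6's `galoisLevelData_faithfulV`).
[cite: MochizukiSemiAnbd2006, Thm 3.7(i) p.40] -/
theorem faithfulV_ofOpenNormalSeq :
    ∀ (v : 𝒢.graph.Vertex) (h : 𝒢.Gv v),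
      (∀ (k : ℕ) (y : (((GaloisLevelData.ofOpenNormalSeq 𝒢 h37.toProp36Hypotheses.isConnected
          (𝒢.baseVertex h37.toProp36Hypotheses) V hVn hanti).S k).SV v).obj.V),
        (((GaloisLevelData.ofOpenNormalSeq 𝒢 h37.toProp36Hypotheses.isConnected
          (𝒢.baseVertex h37.toProp36Hypotheses) V hVn hanti).S k).SV v).obj.ρ h y = y) → h = 1 := by
  refine GaloisLevelData.faithfulV_of_dominates (𝒢.galoisLevelData h37.toProp36Hypotheses) _ (fun n => ?_)
    (fun v h hfix => 𝒢.galoisLevelData_faithfulV h37 v h hfix)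
  obtain ⟨k, hk⟩ := hdom n
  obtain ⟨f⟩ := GaloisLevelData.ofOpenNormalSeq_dominates 𝒢 h37.toProp36Hypotheses V hVn hanti hk
  refine ⟨k, f, fun v => ?_⟩
  -- `f` comes from `B(𝒢)` (fullness of `ofBObj`); maps between connected Galois objects are onto on fibres
  letI := SemiGraphOfAnabelioids.galoisCategory_bObj 𝒢.toAnab ⟨h37.toProp36Hypotheses.isConnected⟩
  have hf : 𝒢.ofBObj.map (𝒢.ofBObj.preimage f) = f := 𝒢.ofBObj.map_preimage f
  rw [← hf]
  exact 𝒢.ofBObj_map_fV_surjective_of_isGalois h37.toProp36Hypotheses.isConnected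
    (𝒢.openNormalObj_isGalois h37.toProp36Hypotheses.isConnected _ V hVn k)
    (𝒢.isGalois_tower h37.toProp36Hypotheses n) _ v

end OpenNormal

end ProfiniteSemiGraph

end Literature.AnabelianGeometry.SemiGraphs
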